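import Literature.NumberTheory.EllipticCurves.FunctionFieldTranslation
import Literature.NumberTheory.EllipticCurves.VariableChangePoints
import HarnessLib

/-!
# The function field under an admissible change of variables

Topic `NumberTheory/EllipticCurves`. For a Weierstrass curve `V` over a field `k` and an
admissible change of variables `C = (u, r, s, t)` (Mathlib's `WeierstrassCurve.VariableChange`,
acting by `C • V`; Silverman, *AEC*, III.§1, `x = u²x' + r`, `y = u³y' + u²sx' + t`), the
substitution identifies the function fields: **`k(C • V) ≃ₐ[k] k(V)`**, `x' ↦ u⁻²(x - r)`,
`y' ↦ u⁻³(y - s(x - r) - t)` (`variableChangeAlgEquiv`, with inverse `x ↦ u²x' + r`,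
`y ↦ u³y' + u²sx' + t`). "Any two Weierstrass equations for `E` are related by a linear change of
variables" (Silverman, *AEC*, Prop. III.3.1(b)); this file supplies the easy direction — a change
of variables is an isomorphism of curves, hence of function fields — as a genuine definition,
built from the tree's `funcAlgHom` (`FunctionFieldTranslation`: the `k`-algebra map out of `k(V)`
determined by a solution of the equation with transcendental first coordinate) and the
polynomial identity `(C • V)(x', y') = u⁻⁶ V(x, y)` (`VariableChange.evalEval_polynomial_toXY` of
`VariableChangePoints`). Used in `DiophantineGeometry/BelyiDegreeThreeJZero` to transport Belyi
degrees between models (`deg_B(E) = 3 ↔ j(E) = 0`).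

## Contents

* `variableChangeAlgHom V C : k(C • V) →ₐ[k] k(V)` and `variableChangeInvAlgHom V C`, their values
  on `x', y'` resp. `x, y` (`…_xF`, `…_yF`), and that they are mutually inverse;
* `variableChangeAlgEquiv V C : k(C • V) ≃ₐ[k] k(V)` (`variableChangeAlgEquiv_xF/_yF`,
  `variableChangeAlgEquiv_symm_xF/_yF`).

## References

* J. H. Silverman, *The Arithmetic of Elliptic Curves*, 2nd ed., GTM 106, Springer 2009, III.§1
  (p. 42, Table 3.1), Prop. III.3.1(b). [SilvermanAEC2009]
-/

noncomputable section

open Polynomial WeierstrassCurve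

universe u

namespace Literature.NumberTheory.EllipticCurves.WeierstrassFunctionField

variable {k : Type u} [Field k] (V : WeierstrassCurve k) (C : VariableChange k)

/-! ### The substitution in a `k`-algebra -/

section Substitution

variable {A : Type*} [CommRing A] [Algebra k A]

/-- The substituted coordinates `(x', y') = (u⁻²(x - r), u⁻³(y - s(x - r) - t))` of a solution
`(x, y)` of `V` in a `k`-algebra solve `C • V`. [cite: SilvermanAEC2009, III.1 Table 3.1] -/
theorem evalEval_smul_toXY {x y : A}
    (h : (V.toAffine.polynomial.map (mapRingHom (algebraMap k A))).evalEval x y = 0) :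
    ((C • V).toAffine.polynomial.map (mapRingHom (algebraMap k A))).evalEval
      ((C.map (algebraMap k A)).toX x) ((C.map (algebraMap k A)).toY x y) = 0 := by
  have h1 := VariableChange.evalEval_polynomial_toXY (V.map (algebraMap k A))
    (C.map (algebraMap k A)) x y
  rw [map_variableChange, Affine.map_polynomial, Affine.map_polynomial] at h1
  rw [h1, h, mul_zero]

/-- Conversely `(x, y) = (u²x' + r, u³y' + u²sx' + t)` solves `V` if `(x', y')` solves `C • V`.
[cite: SilvermanAEC2009, III.1 Table 3.1] -/
theorem evalEval_ofXY {x' y' : A}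
    (h : ((C • V).toAffine.polynomial.map (mapRingHom (algebraMap k A))).evalEval x' y' = 0) :
    (V.toAffine.polynomial.map (mapRingHom (algebraMap k A))).evalEval
      ((C.map (algebraMap k A)).ofX x') ((C.map (algebraMap k A)).ofY x' y') = 0 := by
  have h1 := VariableChange.evalEval_polynomial_toXY (V.map (algebraMap k A))
    (C.map (algebraMap k A)) ((C.map (algebraMap k A)).ofX x') ((C.map (algebraMap k A)).ofY x' y')
  rw [VariableChange.toX_ofX, VariableChange.toY_ofY, map_variableChange, Affine.map_polynomial,
    Affine.map_polynomial, h] at h1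
  exact ((C.map (algebraMap k A)).u⁻¹.isUnit.pow 6).mul_right_eq_zero.1 h1.symm

/-- A `k`-algebra map commutes with the substitution `toX`. [folklore] -/
theorem algHom_toX {B : Type*} [CommRing B] [Algebra k B] (σ : A →ₐ[k] B) (x : A) :
    σ ((C.map (algebraMap k A)).toX x) = (C.map (algebraMap k B)).toX (σ x) := by
  simp [VariableChange.toX_def, VariableChange.map, map_mul, map_sub, AlgHom.commutes]

/-- A `k`-algebra map commutes with the substitution `toY`. [folklore] -/
theorem algHom_toY {B : Type*} [CommRing B] [Algebra k B] (σ : A →ₐ[k] B) (x y : A) :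
    σ ((C.map (algebraMap k A)).toY x y) = (C.map (algebraMap k B)).toY (σ x) (σ y) := by
  simp [VariableChange.toY_def, VariableChange.map, map_mul, map_sub, AlgHom.commutes]

/-- A `k`-algebra map commutes with the inverse substitution `ofX`. [folklore] -/
theorem algHom_ofX {B : Type*} [CommRing B] [Algebra k B] (σ : A →ₐ[k] B) (x' : A) :
    σ ((C.map (algebraMap k A)).ofX x') = (C.map (algebraMap k B)).ofX (σ x') := by
  simp [VariableChange.ofX_def, VariableChange.map, map_mul, map_add, AlgHom.commutes]

/-- A `k`-algebra map commutes with the inverse substitution `ofY`. [folklore] -/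
theorem algHom_ofY {B : Type*} [CommRing B] [Algebra k B] (σ : A →ₐ[k] B) (x' y' : A) :
    σ ((C.map (algebraMap k A)).ofY x' y') = (C.map (algebraMap k B)).ofY (σ x') (σ y') := by
  simp [VariableChange.ofY_def, VariableChange.map, map_mul, map_add, AlgHom.commutes]

end Substitution

/-! ### The `k`-algebra isomorphism `k(C • V) ≃ k(V)` -/

/-- `x' = u⁻²(x - r) ∈ k(V)` is transcendental over `k` (as `x = u²x' + r` is). [folklore] -/
theorem transcendental_toX :
    Transcendental k ((C.map (algebraMap k V.toAffine.FunctionField)).toX (xF V.toAffine)) := by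
  intro ht
  apply transcendental_xF V.toAffine
  rw [← VariableChange.ofX_toX (C.map (algebraMap k V.toAffine.FunctionField)) (xF V.toAffine),
    VariableChange.ofX_def]
  simp only [VariableChange.map, Units.coe_map, MonoidHom.coe_coe]
  exact (((isAlgebraic_algebraMap _).pow 2).mul ht).add (isAlgebraic_algebraMap _)

/-- `x = u²x' + r ∈ k(C • V)` is transcendental over `k`. [folklore] -/
theorem transcendental_ofX :
    Transcendental k ((C.map (algebraMap k (C • V).toAffine.FunctionField)).ofX
      (xF (C • V).toAffine)) := by
  intro ht
  apply transcendental_xF (C • V).toAffine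
  rw [← VariableChange.toX_ofX (C.map (algebraMap k (C • V).toAffine.FunctionField))
    (xF (C • V).toAffine), VariableChange.toX_def]
  simp only [VariableChange.map, MonoidHom.coe_coe, Units.coe_map_inv]
  exact ((isAlgebraic_algebraMap _).pow 2).mul (ht.sub (isAlgebraic_algebraMap _))

/-- **The substitution `k(C • V) → k(V)`, `x' ↦ u⁻²(x - r)`, `y' ↦ u⁻³(y - s(x - r) - t)`** (a
change of variables is a morphism of curves `V → C • V`).
[cite: SilvermanAEC2009, III.1 Table 3.1] -/
def variableChangeAlgHom : (C • V).toAffine.FunctionField →ₐ[k] V.toAffine.FunctionField :=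
  funcAlgHom ((C.map (algebraMap k V.toAffine.FunctionField)).toX (xF V.toAffine))
    ((C.map (algebraMap k V.toAffine.FunctionField)).toY (xF V.toAffine) (yF V.toAffine))
    (evalEval_smul_toXY V C (evalEval_xF_yF V.toAffine)) (transcendental_toX V C)

/-- `x' ↦ u⁻²(x - r)`. [cite: SilvermanAEC2009, III.1 Table 3.1] -/
theorem variableChangeAlgHom_xF : variableChangeAlgHom V C (xF (C • V).toAffine) =
    (C.map (algebraMap k V.toAffine.FunctionField)).toX (xF V.toAffine) :=
  funcAlgHom_xF _ _ _ _

/-- `y' ↦ u⁻³(y - s(x - r) - t)`. [cite: SilvermanAEC2009, III.1 Table 3.1] -/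
theorem variableChangeAlgHom_yF : variableChangeAlgHom V C (yF (C • V).toAffine) =
    (C.map (algebraMap k V.toAffine.FunctionField)).toY (xF V.toAffine) (yF V.toAffine) :=
  funcAlgHom_yF _ _ _ _

/-- **The inverse substitution `k(V) → k(C • V)`, `x ↦ u²x' + r`, `y ↦ u³y' + u²sx' + t`.**
[cite: SilvermanAEC2009, III.1 Table 3.1] -/
def variableChangeInvAlgHom : V.toAffine.FunctionField →ₐ[k] (C • V).toAffine.FunctionField :=
  funcAlgHom ((C.map (algebraMap k (C • V).toAffine.FunctionField)).ofX (xF (C • V).toAffine))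
    ((C.map (algebraMap k (C • V).toAffine.FunctionField)).ofY (xF (C • V).toAffine)
      (yF (C • V).toAffine))
    (evalEval_ofXY V C (evalEval_xF_yF (C • V).toAffine)) (transcendental_ofX V C)

/-- `x ↦ u²x' + r`. [cite: SilvermanAEC2009, III.1 Table 3.1] -/
theorem variableChangeInvAlgHom_xF : variableChangeInvAlgHom V C (xF V.toAffine) =
    (C.map (algebraMap k (C • V).toAffine.FunctionField)).ofX (xF (C • V).toAffine) :=
  funcAlgHom_xF _ _ _ _

/-- `y ↦ u³y' + u²sx' + t`. [cite: SilvermanAEC2009, III.1 Table 3.1] -/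
theorem variableChangeInvAlgHom_yF : variableChangeInvAlgHom V C (yF V.toAffine) =
    (C.map (algebraMap k (C • V).toAffine.FunctionField)).ofY (xF (C • V).toAffine)
      (yF (C • V).toAffine) :=
  funcAlgHom_yF _ _ _ _

/-- The two substitutions are inverse: `k(C • V) → k(V) → k(C • V)` is the identity. [folklore] -/
theorem variableChangeInvAlgHom_comp :
    (variableChangeInvAlgHom V C).comp (variableChangeAlgHom V C) = AlgHom.id k _ := by
  refine algHom_ext_xy ?_ ?_
  · rw [AlgHom.comp_apply, variableChangeAlgHom_xF, algHom_toX, variableChangeInvAlgHom_xF,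
      VariableChange.toX_ofX, AlgHom.id_apply]
  · rw [AlgHom.comp_apply, variableChangeAlgHom_yF, algHom_toY, variableChangeInvAlgHom_xF,
      variableChangeInvAlgHom_yF, VariableChange.toY_ofY, AlgHom.id_apply]

/-- The two substitutions are inverse: `k(V) → k(C • V) → k(V)` is the identity. [folklore] -/
theorem variableChangeAlgHom_comp :
    (variableChangeAlgHom V C).comp (variableChangeInvAlgHom V C) = AlgHom.id k _ := by
  refine algHom_ext_xy ?_ ?_
  · rw [AlgHom.comp_apply, variableChangeInvAlgHom_xF, algHom_ofX, variableChangeAlgHom_xF,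
      VariableChange.ofX_toX, AlgHom.id_apply]
  · rw [AlgHom.comp_apply, variableChangeInvAlgHom_yF, algHom_ofY, variableChangeAlgHom_xF,
      variableChangeAlgHom_yF, VariableChange.ofY_toY, AlgHom.id_apply]

/-- **`k(C • V) ≃ₐ[k] k(V)`: an admissible change of variables identifies the function fields**
(Silverman, *AEC*, III.§1; the morphism of curves `(x, y) ↦ (u⁻²(x - r), u⁻³(y - s(x - r) - t))`
is an isomorphism). [cite: SilvermanAEC2009, Prop. III.3.1(b)] -/
def variableChangeAlgEquiv : (C • V).toAffine.FunctionField ≃ₐ[k] V.toAffine.FunctionField :=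
  AlgEquiv.ofAlgHom (variableChangeAlgHom V C) (variableChangeInvAlgHom V C)
    (variableChangeAlgHom_comp V C) (variableChangeInvAlgHom_comp V C)

/-- `variableChangeAlgEquiv` acts as `variableChangeAlgHom`. [folklore] -/
theorem variableChangeAlgEquiv_apply (z : (C • V).toAffine.FunctionField) :
    variableChangeAlgEquiv V C z = variableChangeAlgHom V C z :=
  rfl

/-- Its inverse acts as `variableChangeInvAlgHom`. [folklore] -/
theorem variableChangeAlgEquiv_symm_apply (z : V.toAffine.FunctionField) :
    (variableChangeAlgEquiv V C).symm z = variableChangeInvAlgHom V C z :=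
  rfl

/-- `x' ↦ u⁻²(x - r)`. [cite: SilvermanAEC2009, III.1 Table 3.1] -/
theorem variableChangeAlgEquiv_xF : variableChangeAlgEquiv V C (xF (C • V).toAffine) =
    (C.map (algebraMap k V.toAffine.FunctionField)).toX (xF V.toAffine) :=
  variableChangeAlgHom_xF V C

/-- `y' ↦ u⁻³(y - s(x - r) - t)`. [cite: SilvermanAEC2009, III.1 Table 3.1] -/
theorem variableChangeAlgEquiv_yF : variableChangeAlgEquiv V C (yF (C • V).toAffine) =
    (C.map (algebraMap k V.toAffine.FunctionField)).toY (xF V.toAffine) (yF V.toAffine) :=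
  variableChangeAlgHom_yF V C

/-- `x ↦ u²x' + r` under the inverse. [cite: SilvermanAEC2009, III.1 Table 3.1] -/
theorem variableChangeAlgEquiv_symm_xF : (variableChangeAlgEquiv V C).symm (xF V.toAffine) =
    (C.map (algebraMap k (C • V).toAffine.FunctionField)).ofX (xF (C • V).toAffine) :=
  variableChangeInvAlgHom_xF V C

/-- `y ↦ u³y' + u²sx' + t` under the inverse. [cite: SilvermanAEC2009, III.1 Table 3.1] -/
theorem variableChangeAlgEquiv_symm_yF : (variableChangeAlgEquiv V C).symm (yF V.toAffine) =
    (C.map (algebraMap k (C • V).toAffine.FunctionField)).ofY (xF (C • V).toAffine)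
      (yF (C • V).toAffine) :=
  variableChangeInvAlgHom_yF V C

end Literature.NumberTheory.EllipticCurves.WeierstrassFunctionField

end
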